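import Literature.Topology.FourManifolds.HandleChartMap
import Literature.Topology.FourManifolds.Cobordism
import Mathlib.Analysis.InnerProductSpace.Calculus
import HarnessLib

/-!
# The feet of a `1`-handle in the level below it

Topic `Literature/Topology/FourManifolds` (fact seat
`provefact-Literature.Topology.FourManifolds.IsHandlebody.exists_isBoundaryGluing_sphere`, step F2b of
the Lickorish–Wallace DAG; data layer of the handle-extension step of the classification of
handlebodies: matching the feet of the two handles).  Everything here is **proved**; no named
facts.

In Milnor's coordinates `u = (u₀, y) ∈ ℝ × ℝⁿ` of index `1` about a critical point `p`
(`f = f p - u₀² + ‖y‖²`, `Literature.Topology.FourManifolds.HandleChart` with `k = 1`; the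
splitting `ℝⁿ⁺¹ = ℝ × ℝⁿ` is `BoundaryManifold.consCLE`), the level `f = f p - m` (`m > 0`)
below `p` meets the chart in the two sheets `u₀ = ±√(m + ‖y‖²)`; the **feet** of the handle are
the two discs of small `‖y‖` on them.  This file parametrises them:

* `Literature.Topology.FourManifolds.footModel n s m ρ : ℝⁿ → ℝⁿ⁺¹`,
  `w ↦ (s √(m + ‖y‖²), y)` with `y = ρ · univUnitBall w` (`s = ±1`), a smooth injective map
  onto the part `‖y‖ < ρ` of the sheet `sign u₀ = s` of the model level `Q₁ = -m`, with the
  smooth left inverse `footModelInv`; the closed unit ball goes onto `‖y‖ ≤ ρ/√2`;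
* `HandleChart.foot D s m ρ : ℝⁿ → M` — the same read through the chart of `D`: smooth, on the
  level `f p - m`, with coordinates `footModel`, range `= O ∩ f⁻¹(f p - m)` for the open set
  `HandleChart.footDomain` on which `footModelInv ∘ coord` is a smooth left inverse
  (`range_foot`, `footInv_foot`), the two feet disjoint (`disjoint_range_foot`), carried to the
  feet of another chart by the chart map (`chartMap_foot`), and **containing every point of the
  level with `|x⃗|²|y⃗|² ≤ γ`** in the image of the closed unit ball once `2γ ≤ m ρ²`
  (`exists_eq_foot`) — the feet columns of `HandleRegion.lean` flowed down to the level.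

These are the hypotheses of `isSmoothEmbedding_levelLift` (`LevelEmbedding.lean`), which turns
the feet into embedded discs of the level manifold, as in Milnor's proof of Thm. 3.13.

## References

* J. Milnor, *Lectures on the h-cobordism theorem* (1965), Def. 3.1, Def. 3.9 and proof of
  Thm. 3.13 (PDF pp. 14–19). [MilnorHCobordism1965]
-/

open scoped Manifold ContDiff Topology
open Set Function Filter Metric OpenPartialHomeomorph

noncomputable section

namespace Literature.Topology.FourManifolds

universe u

/-- Local notation: `𝔼 m` is the model Euclidean space `EuclideanSpace ℝ (Fin m)`. -/
local notation "𝔼 " m:arg => EuclideanSpace ℝ (Fin m)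

open BoundaryManifold

/-! ### Milnor coordinates of index `1`: `u = (u₀, y)` -/

section Model

variable {n : ℕ}

/-- `|x⃗|²` of index `1` is `u₀²`. [cite: MilnorHCobordism1965, Def. 3.1] -/
theorem sqSumLT_one_consCLE (y : 𝔼 n) (t : ℝ) : sqSumLT 1 (consCLE n (y, t)) = t ^ 2 := by
  rw [sqSumLT]
  have h : Finset.univ.filter (fun i : Fin (n + 1) => (i : ℕ) < 1) = {0} := by
    ext i
    simp only [Finset.mem_filter, Finset.mem_univ, true_and, Finset.mem_singleton, Nat.lt_one_iff]
    constructor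
    · intro hi; exact Fin.eq_of_val_eq (by rw [Fin.val_zero]; exact hi)
    · intro hi; rw [hi, Fin.val_zero]
  rw [h, Finset.sum_singleton, consCLE_apply_zero]

/-- `|y⃗|²` of index `1` is `‖y‖²`. [cite: MilnorHCobordism1965, Def. 3.1] -/
theorem sqSumGE_one_consCLE (y : 𝔼 n) (t : ℝ) : sqSumGE 1 (consCLE n (y, t)) = ‖y‖ ^ 2 := by
  rw [sqSumGE]
  have h : Finset.univ.filter (fun i : Fin (n + 1) => 1 ≤ (i : ℕ)) =
      Finset.univ.map ⟨Fin.succ, Fin.succ_injective n⟩ := by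
    ext i
    simp only [Finset.mem_filter, Finset.mem_univ, true_and, Finset.mem_map, Function.Embedding.coeFn_mk]
    constructor
    · intro hi
      refine ⟨i.pred (fun h0 => by rw [h0] at hi; simp at hi), Fin.succ_pred _ _⟩
    · rintro ⟨j, rfl⟩; simp
  rw [h, Finset.sum_map, EuclideanSpace.real_norm_sq_eq]
  simp [consCLE_apply_succ]

/-- Milnor's quadratic form of index `1` in the coordinates `(u₀, y)`: `-u₀² + ‖y‖²`. [cite: MilnorHCobordism1965, Def. 3.1] -/
theorem milnorQuadratic_one_consCLE (y : 𝔼 n) (t : ℝ) : milnorQuadratic 1 (consCLE n (y, t)) = -t ^ 2 + ‖y‖ ^ 2 := by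
  rw [milnorQuadratic_eq, sqSumLT_one_consCLE, sqSumGE_one_consCLE]

/-- The norm in the coordinates `(u₀, y)`: `‖u‖² = u₀² + ‖y‖²`. [folklore] -/
theorem norm_consCLE_sq (y : 𝔼 n) (t : ℝ) : ‖consCLE n (y, t)‖ ^ 2 = t ^ 2 + ‖y‖ ^ 2 := by
  rw [← sqSumLT_add_sqSumGE 1, sqSumLT_one_consCLE, sqSumGE_one_consCLE]

/-- The tail of `consCLE n (y, t)` is `y`. [folklore] -/
theorem tail_consCLE' (y : 𝔼 n) (t : ℝ) : tail n (consCLE n (y, t)) = y := tail_consCLE n (y, t)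

/-! ### The model feet -/

/-- The scaled unit-ball map `y = ρ · univUnitBall w`, `‖y‖ < ρ`. [folklore] -/
def footRadial (n : ℕ) (ρ : ℝ) (w : 𝔼 n) : 𝔼 n := ρ • (univUnitBall w : 𝔼 n)

/-- Its inverse on `‖y‖ < ρ`. [folklore] -/
def footRadialInv (n : ℕ) (ρ : ℝ) (y : 𝔼 n) : 𝔼 n := univUnitBall.symm (ρ⁻¹ • y)

/-- Norm of the unit-ball map. [folklore] -/
theorem norm_univUnitBall (w : 𝔼 n) : ‖(univUnitBall w : 𝔼 n)‖ = ‖w‖ / √(1 + ‖w‖ ^ 2) := by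
  rw [univUnitBall_apply, norm_smul, Real.norm_eq_abs, abs_inv, abs_of_pos (by positivity)]
  ring

/-- The unit-ball map lands in the unit ball. [folklore] -/
theorem norm_univUnitBall_lt_one (w : 𝔼 n) : ‖(univUnitBall w : 𝔼 n)‖ < 1 := by
  have := univUnitBall.map_source (mem_univ w : w ∈ (univUnitBall (E := 𝔼 n)).source)
  rw [univUnitBall_target, mem_ball_zero_iff] at this
  exact this

/-- `‖y‖ < ρ`. [folklore] -/
theorem norm_footRadial_lt {ρ : ℝ} (hρ : 0 < ρ) (w : 𝔼 n) : ‖footRadial n ρ w‖ < ρ := by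
  rw [footRadial, norm_smul, Real.norm_eq_abs, abs_of_pos hρ]
  have := norm_univUnitBall_lt_one w
  nlinarith

/-- The closed unit ball goes into `‖y‖ ≤ ρ/√2`… and conversely: `‖y‖ ≤ ρ / √2` forces
`‖w‖ ≤ 1` for `y = footRadial w`. [folklore] -/
theorem norm_le_one_of_norm_footRadial_le {ρ : ℝ} (hρ : 0 < ρ) {w : 𝔼 n}
    (h : ‖footRadial n ρ w‖ ≤ ρ / √2) : ‖w‖ ≤ 1 := by
  rw [footRadial, norm_smul, Real.norm_eq_abs, abs_of_pos hρ, norm_univUnitBall] at h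
  have h2 : (0 : ℝ) < √2 := by positivity
  have hs : 0 < √(1 + ‖w‖ ^ 2) := by positivity
  have h' : ‖w‖ / √(1 + ‖w‖ ^ 2) ≤ 1 / √2 := by
    have hh : ρ * (‖w‖ / √(1 + ‖w‖ ^ 2)) ≤ ρ * (1 / √2) := by rw [mul_one_div]; exact h
    exact le_of_mul_le_mul_left hh hρ
  rw [div_le_div_iff₀ hs h2, one_mul] at h'
  have h3 : ‖w‖ ^ 2 * 2 ≤ 1 + ‖w‖ ^ 2 := by
    have := mul_self_le_mul_self (by positivity) h'
    rw [← pow_two, ← pow_two, mul_pow, Real.sq_sqrt (by positivity), Real.sq_sqrt (by positivity)] at this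
    linarith
  nlinarith [norm_nonneg w]

/-- Left inverse of the radial map. [folklore] -/
theorem footRadialInv_footRadial {ρ : ℝ} (hρ : 0 < ρ) (w : 𝔼 n) : footRadialInv n ρ (footRadial n ρ w) = w := by
  rw [footRadialInv, footRadial, smul_smul, inv_mul_cancel₀ hρ.ne', one_smul]
  exact univUnitBall.left_inv (mem_univ w)

/-- Right inverse of the radial map on the ball. [folklore] -/
theorem footRadial_footRadialInv {ρ : ℝ} (hρ : 0 < ρ) {y : 𝔼 n} (hy : ‖y‖ < ρ) :
    footRadial n ρ (footRadialInv n ρ y) = y := by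
  have hmem : ρ⁻¹ • y ∈ (univUnitBall (E := 𝔼 n)).target := by
    rw [univUnitBall_target, mem_ball_zero_iff, norm_smul, Real.norm_eq_abs, abs_inv, abs_of_pos hρ]
    rwa [inv_mul_lt_iff₀ hρ, mul_one]
  rw [footRadial, footRadialInv, univUnitBall.right_inv hmem, smul_smul, mul_inv_cancel₀ hρ.ne', one_smul]

/-- The radial map is smooth. [folklore] -/
theorem contDiff_footRadial (ρ : ℝ) : ContDiff ℝ ∞ (footRadial n ρ) := by
  unfold footRadial
  exact contDiff_univUnitBall.const_smul ρ

/-- Its inverse is smooth on the ball. [folklore] -/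
theorem contDiffOn_footRadialInv {ρ : ℝ} (hρ : 0 < ρ) : ContDiffOn ℝ ∞ (footRadialInv n ρ) (ball 0 ρ) := by
  unfold footRadialInv
  refine contDiffOn_univUnitBall_symm.comp (contDiff_id.const_smul ρ⁻¹).contDiffOn fun y hy => ?_
  rw [mem_ball_zero_iff] at hy ⊢
  rw [norm_smul, Real.norm_eq_abs, abs_inv, abs_of_pos hρ]
  rwa [inv_mul_lt_iff₀ hρ, mul_one]

/-- **The model feet**: `w ↦ (s √(m + ‖y‖²), y)`, `y = footRadial w`. [cite: MilnorHCobordism1965, proof of Thm. 3.13 (PDF p. 18)] -/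
def footModel (n : ℕ) (s m ρ : ℝ) (w : 𝔼 n) : 𝔼 (n + 1) :=
  consCLE n (footRadial n ρ w, s * √(m + ‖footRadial n ρ w‖ ^ 2))

/-- The left inverse of the model feet: `u ↦ footRadialInv (tail u)`. [folklore] -/
def footModelInv (n : ℕ) (ρ : ℝ) (u : 𝔼 (n + 1)) : 𝔼 n := footRadialInv n ρ (tail n u)

variable {s m ρ : ℝ}

/-- First coordinate of the model feet. [folklore] -/
theorem footModel_apply_zero (w : 𝔼 n) : footModel n s m ρ w 0 = s * √(m + ‖footRadial n ρ w‖ ^ 2) :=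
  consCLE_apply_zero n _

/-- Tail of the model feet. [folklore] -/
theorem tail_footModel (w : 𝔼 n) : tail n (footModel n s m ρ w) = footRadial n ρ w := tail_consCLE n _

/-- The model feet lie on the model level `Q₁ = -m` (`s² = 1`, `m ≥ 0`). [cite: MilnorHCobordism1965, Def. 3.1] -/
theorem milnorQuadratic_footModel (hs : s ^ 2 = 1) (hm : 0 ≤ m) (w : 𝔼 n) :
    milnorQuadratic 1 (footModel n s m ρ w) = -m := by
  rw [footModel, milnorQuadratic_one_consCLE, mul_pow, hs, one_mul, Real.sq_sqrt (by positivity)]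
  ring

/-- `|x⃗|²` and `|y⃗|²` of the model feet. [folklore] -/
theorem sqSumLT_footModel (hs : s ^ 2 = 1) (hm : 0 ≤ m) (w : 𝔼 n) :
    sqSumLT 1 (footModel n s m ρ w) = m + ‖footRadial n ρ w‖ ^ 2 := by
  rw [footModel, sqSumLT_one_consCLE, mul_pow, hs, one_mul, Real.sq_sqrt (by positivity)]

/-- `|y⃗|²` of the model feet. [folklore] -/
theorem sqSumGE_footModel (w : 𝔼 n) : sqSumGE 1 (footModel n s m ρ w) = ‖footRadial n ρ w‖ ^ 2 := by
  rw [footModel, sqSumGE_one_consCLE]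

/-- The norm of the model feet: `‖u‖² = m + 2‖y‖² < m + 2ρ²`. [folklore] -/
theorem norm_footModel_sq (hs : s ^ 2 = 1) (hm : 0 ≤ m) (w : 𝔼 n) :
    ‖footModel n s m ρ w‖ ^ 2 = m + 2 * ‖footRadial n ρ w‖ ^ 2 := by
  rw [← sqSumLT_add_sqSumGE 1, sqSumLT_footModel hs hm, sqSumGE_footModel]; ring

/-- The model feet lie in the ball of radius `R` once `m + 2ρ² ≤ R²`. [folklore] -/
theorem norm_footModel_lt (hs : s ^ 2 = 1) (hm : 0 ≤ m) (hρ : 0 < ρ) {R : ℝ} (hR : 0 < R)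
    (hmR : m + 2 * ρ ^ 2 ≤ R ^ 2) (w : 𝔼 n) : ‖footModel n s m ρ w‖ < R := by
  have h1 := norm_footModel_sq (n := n) (ρ := ρ) hs hm w
  have h2 := norm_footRadial_lt (n := n) hρ w
  have h3 : ‖footModel n s m ρ w‖ ^ 2 < R ^ 2 := by nlinarith [norm_nonneg (footRadial n ρ w)]
  exact (pow_lt_pow_iff_left₀ (norm_nonneg _) hR.le two_ne_zero).1 h3

/-- The sign of the first coordinate of the model feet is `s` (`m > 0`). [folklore] -/
theorem mul_footModel_apply_zero_pos (hs : s ^ 2 = 1) (hm : 0 < m) (w : 𝔼 n) :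
    0 < s * footModel n s m ρ w 0 := by
  rw [footModel_apply_zero, ← mul_assoc, ← pow_two, hs, one_mul]
  positivity

/-- The left inverse. [folklore] -/
theorem footModelInv_footModel (hρ : 0 < ρ) (w : 𝔼 n) : footModelInv n ρ (footModel n s m ρ w) = w := by
  rw [footModelInv, tail_footModel, footRadialInv_footRadial hρ]

/-- The model feet are smooth (`m > 0`). [folklore] -/
theorem contDiff_footModel (hm : 0 < m) : ContDiff ℝ ∞ (footModel n s m ρ) := by
  unfold footModel
  refine (consCLE n).contDiff.comp ((contDiff_footRadial ρ).prodMk (contDiff_const.mul ?_))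
  refine ContDiff.sqrt (contDiff_const.add ((contDiff_footRadial ρ).norm_sq ℝ)) fun w => ?_
  positivity

/-- The model left inverse is smooth on `‖tail u‖ < ρ`. [folklore] -/
theorem contDiffOn_footModelInv (hρ : 0 < ρ) : ContDiffOn ℝ ∞ (footModelInv n ρ) {u | ‖tail n u‖ < ρ} :=
  (contDiffOn_footRadialInv hρ).comp (contDiff_tail n).contDiffOn fun u hu => by
    rw [mem_ball_zero_iff]; exact hu

/-- **Characterisation of the sheets**: a point of the model level `Q₁ = -m` with
`sign u₀ = s` and `‖tail u‖ < ρ` is a model foot point. [cite: MilnorHCobordism1965, Def. 3.1] -/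
theorem footModel_footModelInv (hs : s ^ 2 = 1) (hρ : 0 < ρ) {u : 𝔼 (n + 1)}
    (hQ : milnorQuadratic 1 u = -m) (hsign : 0 < s * u 0) (htail : ‖tail n u‖ < ρ) :
    footModel n s m ρ (footModelInv n ρ u) = u := by
  rw [footModel, footModelInv, footRadial_footRadialInv hρ htail]
  have hu := consCLE_tail n u
  -- `u 0 = s √(m + ‖tail u‖²)`
  have hQ' : milnorQuadratic 1 (consCLE n (tail n u, u 0)) = -m := by rw [hu]; exact hQ
  rw [milnorQuadratic_one_consCLE] at hQ'
  have h0 : u 0 ^ 2 = m + ‖tail n u‖ ^ 2 := by linarith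
  have hs1 : s = 1 ∨ s = -1 := by
    have : (s - 1) * (s + 1) = 0 := by nlinarith
    rcases mul_eq_zero.1 this with h | h
    · left; linarith
    · right; linarith
  have hroot : s * √(m + ‖tail n u‖ ^ 2) = u 0 := by
    rw [← h0, Real.sqrt_sq_eq_abs]
    rcases hs1 with rfl | rfl
    · rw [one_mul] at hsign ⊢; exact abs_of_pos hsign
    · have : u 0 < 0 := by linarith
      rw [abs_of_neg this]; ring
  conv_rhs => rw [← hu]
  rw [hroot]

end Model

/-! ### The feet read through a handle chart -/

namespace HandleChart

variable {n : ℕ} {M : Type u} [TopologicalSpace M] [ChartedSpace (EuclideanHalfSpace (n + 1)) M]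
  {M' : Type u} [TopologicalSpace M'] [ChartedSpace (EuclideanHalfSpace (n + 1)) M']
  {f : M → ℝ} {X : Π x : M, TangentSpace (𝓡∂ (n + 1)) x} {p : M} (D : HandleChart (𝓡∂ (n + 1)) f X p)
  {f' : M' → ℝ} {X' : Π x : M', TangentSpace (𝓡∂ (n + 1)) x} {p' : M'} (D' : HandleChart (𝓡∂ (n + 1)) f' X' p')

/-- **The feet of the handle** in the level `f p - m`, read through the chart of `D`:
`w ↦ φ̂⁻¹ (φ̂ p + footModel w)`. [cite: MilnorHCobordism1965, proof of Thm. 3.13 (PDF p. 18)] -/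
def foot (s m ρ : ℝ) (w : 𝔼 n) : M :=
  (D.chart.extend (𝓡∂ (n + 1))).symm (D.chart.extend (𝓡∂ (n + 1)) p + footModel n s m ρ w)

/-- The left inverse of the feet: `footModelInv ∘ coord`. [folklore] -/
def footInv (ρ : ℝ) (q : M) : 𝔼 n := footModelInv n ρ (D.coord q)

/-- The open set of the chart on which `footInv` inverts `foot s`: chart ball of radius `R`,
sheet `sign u₀ = s`, `‖tail u‖ < ρ`. [folklore] -/
def footDomain (s ρ R : ℝ) : Set M :=
  {q | q ∈ D.chart.source ∧ ‖D.coord q‖ < R ∧ 0 < s * D.coord q 0 ∧ ‖tail n (D.coord q)‖ < ρ}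

variable {s m ρ R : ℝ} (hs : s ^ 2 = 1) (hm : 0 < m) (hρ : 0 < ρ) (hR : 0 < R) (hmR : m + 2 * ρ ^ 2 ≤ R ^ 2)
  (hball : closedBall (D.chart.extend (𝓡∂ (n + 1)) p) R ⊆ (D.chart.extend (𝓡∂ (n + 1))).target)

include hs hm hρ hR hmR hball in
/-- The feet lie in the chart source, with coordinates `footModel`. [folklore] -/
theorem foot_mem_source_and_coord (w : 𝔼 n) :
    D.foot s m ρ w ∈ D.chart.source ∧ D.coord (D.foot s m ρ w) = footModel n s m ρ w :=
  D.symm_add_mem_source hball (norm_footModel_lt hs hm.le hρ hR hmR w).le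

include hs hm hρ hR hmR hball in
/-- **The feet lie on the level `f p - m`.** [cite: MilnorHCobordism1965, Def. 3.1] -/
theorem apply_foot (hk : D.k = 1) (w : 𝔼 n) : f (D.foot s m ρ w) = f p - m := by
  obtain ⟨hsrc, hc⟩ := D.foot_mem_source_and_coord hs hm hρ hR hmR hball w
  have h := D.apply_eq _ hsrc
  change f (D.foot s m ρ w) = f p + milnorQuadratic D.k (D.coord (D.foot s m ρ w)) at h
  rw [h, hc, hk, milnorQuadratic_footModel hs hm.le]; ring

include hs hm hρ hR hmR hball in
/-- The feet lie in the foot domain. [folklore] -/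
theorem foot_mem_footDomain (w : 𝔼 n) : D.foot s m ρ w ∈ D.footDomain s ρ R := by
  obtain ⟨hsrc, hc⟩ := D.foot_mem_source_and_coord hs hm hρ hR hmR hball w
  refine ⟨hsrc, ?_, ?_, ?_⟩
  · rw [hc]; exact norm_footModel_lt hs hm.le hρ hR hmR w
  · rw [hc]; exact mul_footModel_apply_zero_pos hs hm w
  · rw [hc, tail_footModel]; exact norm_footRadial_lt hρ w

include hs hm hρ hR hmR hball in
/-- `footInv ∘ foot = id`. [folklore] -/
theorem footInv_foot (w : 𝔼 n) : D.footInv ρ (D.foot s m ρ w) = w := by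
  rw [footInv, (D.foot_mem_source_and_coord hs hm hρ hR hmR hball w).2, footModelInv_footModel hρ]

include hs hρ in
/-- `foot ∘ footInv = id` on the level points of the foot domain. [folklore] -/
theorem foot_footInv (hk : D.k = 1) {q : M} (hq : q ∈ D.footDomain s ρ R) (hfq : f q = f p - m) :
    D.foot s m ρ (D.footInv ρ q) = q := by
  obtain ⟨hsrc, _, hsign, htail⟩ := hq
  have hQ : milnorQuadratic 1 (D.coord q) = -m := by
    have h := D.apply_eq q hsrc
    change f q = f p + milnorQuadratic D.k (D.coord q) at h
    rw [hk] at h; linarith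
  rw [foot, footInv, footModel_footModelInv hs hρ hQ hsign htail, coord, add_sub_cancel,
    ← D.chart.extend_source (I := 𝓡∂ (n + 1))] at *
  exact (D.chart.extend (𝓡∂ (n + 1))).left_inv hsrc

/-- The foot domain is open. [folklore] -/
theorem isOpen_footDomain : IsOpen (D.footDomain s ρ R) := by
  have hc : ContinuousOn D.coord D.chart.source := D.continuousOn_coord
  have heq : D.footDomain s ρ R = D.chart.source ∩ D.coord ⁻¹' {u | ‖u‖ < R ∧ 0 < s * u 0 ∧ ‖tail n u‖ < ρ} := by
    ext q; simp only [footDomain, mem_setOf_eq, mem_inter_iff, mem_preimage]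
  rw [heq]
  refine hc.isOpen_inter_preimage D.chart.open_source ?_
  exact (isOpen_lt continuous_norm continuous_const).inter ((isOpen_lt continuous_const
    (continuous_const.mul (continuous_apply 0 |>.comp (PiLp.continuous_ofLp 2 _)))).inter
    (isOpen_lt ((continuous_tail n).norm) continuous_const))

/-- `footInv` is smooth on the foot domain. [folklore] -/
theorem contMDiffOn_footInv (hρ : 0 < ρ) :
    ContMDiffOn (𝓡∂ (n + 1)) 𝓘(ℝ, 𝔼 n) ∞ (D.footInv ρ) (D.footDomain s ρ R) := by
  have h1 : ContMDiffOn (𝓡∂ (n + 1)) 𝓘(ℝ, 𝔼 (n + 1)) ∞ D.coord D.chart.source :=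
    (contMDiffOn_extend (I := 𝓡∂ (n + 1)) D.mem_maximalAtlas).sub contMDiffOn_const
  have h2 := (contDiffOn_footModelInv (n := n) hρ).contMDiffOn
  exact h2.comp (h1.mono fun q hq => hq.1) fun q hq => hq.2.2.2

include hm hR hmR hball in
/-- **The feet are smooth.** [folklore] -/
theorem contMDiff_foot [IsManifold (𝓡∂ (n + 1)) ∞ M] (hs : s ^ 2 = 1) (hρ : 0 < ρ) :
    ContMDiff 𝓘(ℝ, 𝔼 n) (𝓡∂ (n + 1)) ∞ (D.foot s m ρ) := by
  intro w
  have hy : D.chart.extend (𝓡∂ (n + 1)) p + footModel n s m ρ w ∈ ball (D.chart.extend (𝓡∂ (n + 1)) p) R := by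
    rw [mem_ball, dist_eq_norm, add_sub_cancel_left]; exact norm_footModel_lt hs hm.le hρ hR hmR w
  exact (D.contMDiffAt_extend_symm hball hy).comp w
    ((contDiff_const.add (contDiff_footModel hm)).contMDiff w)

include hs hm hρ hR hmR hball in
/-- **The range of the feet** is the level part of the foot domain. [folklore] -/
theorem range_foot (hk : D.k = 1) : range (D.foot s m ρ) = D.footDomain s ρ R ∩ f ⁻¹' {f p - m} := by
  apply Subset.antisymm
  · rintro _ ⟨w, rfl⟩
    exact ⟨D.foot_mem_footDomain hs hm hρ hR hmR hball w, D.apply_foot hs hm hρ hR hmR hball hk w⟩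
  · rintro q ⟨hq, hfq⟩
    exact ⟨D.footInv ρ q, D.foot_footInv hs hρ hk hq hfq⟩

include hs hm hρ hR hmR hball in
/-- **The two feet are disjoint** (opposite signs of `u₀`). [folklore] -/
theorem disjoint_range_foot : Disjoint (range (D.foot s m ρ)) (range (D.foot (-s) m ρ)) := by
  have hs' : (-s) ^ 2 = 1 := by rw [neg_sq]; exact hs
  refine disjoint_left.2 ?_
  rintro q ⟨w, rfl⟩ ⟨w', hw'⟩
  have h1 := (D.foot_mem_footDomain hs hm hρ hR hmR hball w).2.2.1
  have h2 := (D.foot_mem_footDomain hs' hm hρ hR hmR hball w').2.2.1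
  rw [hw'] at h2
  linarith

omit D in
/-- **The chart map carries the feet of `D` to the feet of `D'`.** [cite: MilnorHCobordism1965, proof of Thm. 3.13 (PDF p. 18)] -/
theorem chartMap_foot (D : HandleChart (𝓡∂ (n + 1)) f X p) (hs : s ^ 2 = 1) (hm : 0 < m) (hρ : 0 < ρ)
    (hR : 0 < R) (hmR : m + 2 * ρ ^ 2 ≤ R ^ 2)
    (hball : closedBall (D.chart.extend (𝓡∂ (n + 1)) p) R ⊆ (D.chart.extend (𝓡∂ (n + 1))).target) (w : 𝔼 n) :
    D.chartMap D' (D.foot s m ρ w) = D'.foot s m ρ w := by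
  rw [chartMap, (D.foot_mem_source_and_coord hs hm hρ hR hmR hball w).2]; rfl

include hs hm hρ in
/-- **Every point of the level `f p - m` in the chart ball with `|x⃗|²|y⃗|² ≤ γ` is a foot point
of the closed unit ball**, for one of the two signs, once `2γ ≤ m ρ²` (then `‖y‖ ≤ √(γ/m) ≤ ρ/√2`).
[cite: MilnorHCobordism1965, proof of Thm. 3.13 (PDF p. 18)] -/
theorem exists_eq_foot (hk : D.k = 1) {γ : ℝ} (hγ : 2 * γ ≤ m * ρ ^ 2) {q : M} (hq : q ∈ D.chart.source)
    (hfq : f q = f p - m) (hP : sqSumLT 1 (D.coord q) * sqSumGE 1 (D.coord q) ≤ γ) (hqR : ‖D.coord q‖ < R) :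
    ∃ s' : ℝ, (s' = s ∨ s' = -s) ∧ ∃ w : 𝔼 n, ‖w‖ ≤ 1 ∧ q = D.foot s' m ρ w := by
  set u := D.coord q with hu
  have hu' := consCLE_tail n u
  have hQ : milnorQuadratic 1 u = -m := by
    have h := D.apply_eq q hq
    change f q = f p + milnorQuadratic D.k (D.coord q) at h
    rw [hk] at h; linarith
  have hQ' : milnorQuadratic 1 (consCLE n (tail n u, u 0)) = -m := by rw [hu']; exact hQ
  rw [milnorQuadratic_one_consCLE] at hQ'
  have h0sq : u 0 ^ 2 = m + ‖tail n u‖ ^ 2 := by linarith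
  -- `‖tail u‖² ≤ γ / m ≤ ρ² / 2`
  have hLT : sqSumLT 1 u = u 0 ^ 2 := by
    conv_lhs => rw [← hu']
    exact sqSumLT_one_consCLE _ _
  have hGE : sqSumGE 1 u = ‖tail n u‖ ^ 2 := by
    conv_lhs => rw [← hu']
    exact sqSumGE_one_consCLE _ _
  rw [hLT, hGE, h0sq] at hP
  have htail2 : ‖tail n u‖ ^ 2 ≤ ρ ^ 2 / 2 := by
    have h1 : m * ‖tail n u‖ ^ 2 ≤ γ := by nlinarith [sq_nonneg (‖tail n u‖ ^ 2)]
    have h2 : m * ‖tail n u‖ ^ 2 ≤ m * (ρ ^ 2 / 2) := by linarith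
    exact le_of_mul_le_mul_left h2 hm
  have htail : ‖tail n u‖ < ρ := by nlinarith [norm_nonneg (tail n u)]
  have htail' : ‖tail n u‖ ≤ ρ / √2 := by
    rw [le_div_iff₀ (by positivity)]
    have : (‖tail n u‖ * √2) ^ 2 ≤ ρ ^ 2 := by rw [mul_pow, Real.sq_sqrt (by norm_num)]; linarith
    exact (pow_le_pow_iff_left₀ (by positivity) hρ.le two_ne_zero).1 this
  -- the sign of `u 0`
  have h0ne : u 0 ≠ 0 := by
    intro h; rw [h] at h0sq; nlinarith [norm_nonneg (tail n u)]
  have hs1 : s = 1 ∨ s = -1 := by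
    have : (s - 1) * (s + 1) = 0 := by nlinarith
    rcases mul_eq_zero.1 this with h | h
    · left; linarith
    · right; linarith
  -- choose the sign
  obtain ⟨s', hs', hsign⟩ : ∃ s' : ℝ, (s' = s ∨ s' = -s) ∧ 0 < s' * u 0 := by
    rcases lt_or_gt_of_ne h0ne with h | h
    · rcases hs1 with rfl | rfl
      · exact ⟨-1, Or.inr rfl, by linarith⟩
      · exact ⟨-1, Or.inl rfl, by linarith⟩
    · rcases hs1 with rfl | rfl
      · exact ⟨1, Or.inl rfl, by linarith⟩
      · exact ⟨1, Or.inr (by norm_num), by linarith⟩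
  have hs'2 : s' ^ 2 = 1 := by rcases hs' with rfl | rfl <;> [exact hs; (rw [neg_sq]; exact hs)]
  refine ⟨s', hs', D.footInv ρ q, ?_, ?_⟩
  · -- `‖w‖ ≤ 1`
    apply norm_le_one_of_norm_footRadial_le hρ
    rw [footInv, footModelInv, footRadial_footRadialInv hρ htail]
    exact htail'
  · exact (D.foot_footInv hs'2 hρ hk ⟨hq, hqR, hsign, htail⟩ hfq).symm

end HandleChart

end Literature.Topology.FourManifolds
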